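import Summits.CriticalPhenomena.PercolationContinuityZ3.Theorems.PercNearOneGluingNoHeavyLowerTailAntipodalR1CutVertexGrades
import Summits.CriticalPhenomena.PercolationContinuityZ3.Theorems.PercNearOneGluingNoHeavyLowerTailAntipodalR1TwoCutGrades
import HarnessLib

/-!
# ANTI₁ across a cut vertex, graded: the apex block

Support file for `stmt-CriticalPhenomena-4575` (memo `prim-gen-kcluster/KCLUSTER-gen73.md` §1.8 (B),
graded; conjecture ANTI₁-GRADED of `KCLUSTER-gen52.md` §3).  No definitions, no named facts, no sorries.
Vocabulary of `AntipodalR1` (gen 62); `…OneSumApex` (the ungraded case: `mem_lSet_apexBlock`,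
`mem_rSet_of_apexBlock`, `card_eq_sum_card_fibre_left`), `…CutVertexGrades` (the mirror grade shift
`g_G(ω_A ⊕ ω_T) + 2·#I_A = g_T(ω_T) + c^A(ω_A)`) and `card_filter_add_le` (part VII) of gen 78.

**Theorem** (`card_lSet_grade_le_of_apexBlock`).  `G = A ∪ T` glued at the single vertex `u`, the apex
`a` on the `A` side, the terminals `b, c` interior to `T`.  Then ANTI₁-GRADED for `(T; u, b, c)` implies
ANTI₁-GRADED for `(G; a, b, c)`, at every level: fibrewise over `ω_A`, `L(G)`-fibres embed into `L(T)`
and `R(T)` embeds into `R(G)`-fibres (ungraded file) with the constant grade shift `c^A(ω_A) − 2·#I_A`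
(`fibre_grade_le_apexBlock`).  With `…CutVertexGraded` (A), `…OneSumTerminalGraded` (C, D) and
`…OneSumApexCutGraded` (D): ANTI₁-GRADED reduces over every 1-sum, so a counterexample to ANTI₁-GRADED
with the fewest edges is 2-connected.  [this work]
-/

namespace Summit.CriticalPhenomena.PercolationContinuityZ3.Theorems

namespace AntipodalR1

open Finset Relation SimpleGraph

variable {V ιA ιT : Type*}

section Sets

variable {endsA : ιA → Sym2 V} {endsT : ιT → Sym2 V} {u a b c : V}
variable [Fintype V] [Fintype ιA] [DecidableEq ιA] [Fintype ιT] [DecidableEq ιT]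

open Classical in
/-- **The graded fibre inequality** for the apex block: over each colouring `ω_A` of `A`, the
`L(G)`-fibre at level `t` is no larger than the `R(G)`-fibre at level `t`. [this work] -/
theorem fibre_grade_le_apexBlock
    (hsep : ∀ w i, w ∈ endsA i → ∀ j, w ∈ endsT j → w = u) (ha : ∀ j, a ∈ endsT j → a = u)
    (hbT : ∃ j, b ∈ endsT j) (hbu : b ≠ u) (hcT : ∃ j, c ∈ endsT j) (hcu : c ≠ u)
    (h0 : ∀ t, (univ.filter fun ωT : ιT → Bool => ωT ∈ lSet endsT u b c ∧
        (Nat.card (fromEdgeSet {s : Sym2 V | ∃ j, ωT j = true ∧ endsT j = s}).ConnectedComponent +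
        Nat.card (fromEdgeSet {s : Sym2 V | ∃ j, ωT j = false ∧ endsT j = s}).ConnectedComponent) = t).card ≤
      (univ.filter fun ωT : ιT → Bool => ωT ∈ rSet endsT u b c ∧
        (Nat.card (fromEdgeSet {s : Sym2 V | ∃ j, ωT j = true ∧ endsT j = s}).ConnectedComponent +
        Nat.card (fromEdgeSet {s : Sym2 V | ∃ j, ωT j = false ∧ endsT j = s}).ConnectedComponent) = t).card)
    (ωA : ιA → Bool) (t : ℕ) :
    (univ.filter fun ωT : ιT → Bool => Sum.elim ωA ωT ∈ lSet (Sum.elim endsA endsT) a b c ∧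
        (Nat.card (fromEdgeSet {s : Sym2 V | ∃ e, Sum.elim ωA ωT e = true ∧
          Sum.elim endsA endsT e = s}).ConnectedComponent +
        Nat.card (fromEdgeSet {s : Sym2 V | ∃ e, Sum.elim ωA ωT e = false ∧
          Sum.elim endsA endsT e = s}).ConnectedComponent) = t).card ≤
      (univ.filter fun ωT : ιT → Bool => Sum.elim ωA ωT ∈ rSet (Sum.elim endsA endsT) a b c ∧
        (Nat.card (fromEdgeSet {s : Sym2 V | ∃ e, Sum.elim ωA ωT e = true ∧
          Sum.elim endsA endsT e = s}).ConnectedComponent +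
        Nat.card (fromEdgeSet {s : Sym2 V | ∃ e, Sum.elim ωA ωT e = false ∧
          Sum.elim endsA endsT e = s}).ConnectedComponent) = t).card := by
  have hg : ∀ ωT : ιT → Bool, (Nat.card (fromEdgeSet {s : Sym2 V | ∃ e, Sum.elim ωA ωT e = true ∧
          Sum.elim endsA endsT e = s}).ConnectedComponent +
        Nat.card (fromEdgeSet {s : Sym2 V | ∃ e, Sum.elim ωA ωT e = false ∧
          Sum.elim endsA endsT e = s}).ConnectedComponent) +
      2 * Nat.card {w : V | ¬ ∀ i, w ∈ endsA i → w = u} =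
      (Nat.card (fromEdgeSet {s : Sym2 V | ∃ j, ωT j = true ∧ endsT j = s}).ConnectedComponent +
        Nat.card (fromEdgeSet {s : Sym2 V | ∃ j, ωT j = false ∧ endsT j = s}).ConnectedComponent) +
      (Nat.card {D : (fromEdgeSet {s : Sym2 V | ∃ i, ωA i = true ∧ endsA i = s}).ConnectedComponent //
            ¬ ∃ x, x ∉ {w : V | ¬ ∀ i, w ∈ endsA i → w = u} ∧
              (fromEdgeSet {s : Sym2 V | ∃ i, ωA i = true ∧ endsA i = s}).connectedComponentMk x = D} +
          Nat.card {D : (fromEdgeSet {s : Sym2 V | ∃ i, ωA i = false ∧ endsA i = s}).ConnectedComponent //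
            ¬ ∃ x, x ∉ {w : V | ¬ ∀ i, w ∈ endsA i → w = u} ∧
              (fromEdgeSet {s : Sym2 V | ∃ i, ωA i = false ∧ endsA i = s}).connectedComponentMk x = D}) :=
    fun ωT => grade_cutVertex_eq' hsep ωA ωT
  set k := (Nat.card {D : (fromEdgeSet {s : Sym2 V | ∃ i, ωA i = true ∧ endsA i = s}).ConnectedComponent //
            ¬ ∃ x, x ∉ {w : V | ¬ ∀ i, w ∈ endsA i → w = u} ∧
              (fromEdgeSet {s : Sym2 V | ∃ i, ωA i = true ∧ endsA i = s}).connectedComponentMk x = D} +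
          Nat.card {D : (fromEdgeSet {s : Sym2 V | ∃ i, ωA i = false ∧ endsA i = s}).ConnectedComponent //
            ¬ ∃ x, x ∉ {w : V | ¬ ∀ i, w ∈ endsA i → w = u} ∧
              (fromEdgeSet {s : Sym2 V | ∃ i, ωA i = false ∧ endsA i = s}).connectedComponentMk x = D}) with hk
  set T := t + 2 * Nat.card {w : V | ¬ ∀ i, w ∈ endsA i → w = u} with hT
  by_cases hM : u ∈ clus endsA ωA true a ∧ u ∈ clus endsA ωA false a
  · calc (univ.filter fun ωT : ιT → Bool => Sum.elim ωA ωT ∈ lSet (Sum.elim endsA endsT) a b c ∧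
        (Nat.card (fromEdgeSet {s : Sym2 V | ∃ e, Sum.elim ωA ωT e = true ∧
          Sum.elim endsA endsT e = s}).ConnectedComponent +
        Nat.card (fromEdgeSet {s : Sym2 V | ∃ e, Sum.elim ωA ωT e = false ∧
          Sum.elim endsA endsT e = s}).ConnectedComponent) = t).card
        ≤ (univ.filter fun ωT : ιT → Bool => ωT ∈ lSet endsT u b c ∧
            (Nat.card (fromEdgeSet {s : Sym2 V | ∃ j, ωT j = true ∧ endsT j = s}).ConnectedComponent +
        Nat.card (fromEdgeSet {s : Sym2 V | ∃ j, ωT j = false ∧ endsT j = s}).ConnectedComponent) + k = T).card := by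
          refine card_le_card fun ωT h => ?_
          obtain ⟨hL, hgr⟩ := (mem_filter.1 h).2
          exact mem_filter.2 ⟨mem_univ _, (mem_lSet_apexBlock hsep ha hbT hbu hcT hcu hL).2,
            by have := hg ωT; omega⟩
      _ ≤ (univ.filter fun ωT : ιT → Bool => ωT ∈ rSet endsT u b c ∧
            (Nat.card (fromEdgeSet {s : Sym2 V | ∃ j, ωT j = true ∧ endsT j = s}).ConnectedComponent +
        Nat.card (fromEdgeSet {s : Sym2 V | ∃ j, ωT j = false ∧ endsT j = s}).ConnectedComponent) + k = T).card := card_filter_add_le _ _ _ _ h0 k T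
      _ ≤ _ := by
          refine card_le_card fun ωT h => ?_
          obtain ⟨hR, hgr⟩ := (mem_filter.1 h).2
          exact mem_filter.2 ⟨mem_univ _, mem_rSet_of_apexBlock hsep ha hbT hbu hcT hcu hM.1 hM.2 hR,
            by have := hg ωT; omega⟩
  · have h00 : (univ.filter fun ωT : ιT → Bool =>
        Sum.elim ωA ωT ∈ lSet (Sum.elim endsA endsT) a b c ∧
        (Nat.card (fromEdgeSet {s : Sym2 V | ∃ e, Sum.elim ωA ωT e = true ∧
          Sum.elim endsA endsT e = s}).ConnectedComponent +
        Nat.card (fromEdgeSet {s : Sym2 V | ∃ e, Sum.elim ωA ωT e = false ∧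
          Sum.elim endsA endsT e = s}).ConnectedComponent) = t) = ∅ :=
      filter_eq_empty_iff.2 fun ωT _ h => hM (mem_lSet_apexBlock hsep ha hbT hbu hcT hcu h.1).1
    rw [h00, card_empty]
    exact Nat.zero_le _

open Classical in
/-- **The graded 1-sum reduction, apex block** (memo `KCLUSTER-gen73` §1.8 (B), graded kernel form).
`G = A ∪ T` glued at the single vertex `u` (every vertex met by edges of both sides is `u`), the apex `a`
met by edges of `T` only if `a = u`, and the terminals `b, c` interior to `T`.  Then ANTI₁-GRADED for
`(T; u, b, c)` implies ANTI₁-GRADED for `(G; a, b, c)`, at every level.  No other hypothesis on `A`, `T`.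
[this work] -/
theorem card_lSet_grade_le_of_apexBlock (endsA : ιA → Sym2 V) (endsT : ιT → Sym2 V)
    (u a b c : V)
    (hsep : ∀ w i, w ∈ endsA i → ∀ j, w ∈ endsT j → w = u) (ha : ∀ j, a ∈ endsT j → a = u)
    (hbT : ∃ j, b ∈ endsT j) (hbu : b ≠ u) (hcT : ∃ j, c ∈ endsT j) (hcu : c ≠ u)
    (h0 : ∀ t, (univ.filter fun ωT : ιT → Bool => ωT ∈ lSet endsT u b c ∧
        (Nat.card (fromEdgeSet {s : Sym2 V | ∃ j, ωT j = true ∧ endsT j = s}).ConnectedComponent +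
        Nat.card (fromEdgeSet {s : Sym2 V | ∃ j, ωT j = false ∧ endsT j = s}).ConnectedComponent) = t).card ≤
      (univ.filter fun ωT : ιT → Bool => ωT ∈ rSet endsT u b c ∧
        (Nat.card (fromEdgeSet {s : Sym2 V | ∃ j, ωT j = true ∧ endsT j = s}).ConnectedComponent +
        Nat.card (fromEdgeSet {s : Sym2 V | ∃ j, ωT j = false ∧ endsT j = s}).ConnectedComponent) = t).card)
    (t : ℕ) :
    (univ.filter fun x : ιA ⊕ ιT → Bool => x ∈ lSet (Sum.elim endsA endsT) a b c ∧
        (Nat.card (fromEdgeSet {s : Sym2 V | ∃ e, x e = true ∧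
          Sum.elim endsA endsT e = s}).ConnectedComponent +
        Nat.card (fromEdgeSet {s : Sym2 V | ∃ e, x e = false ∧
          Sum.elim endsA endsT e = s}).ConnectedComponent) = t).card ≤
      (univ.filter fun x : ιA ⊕ ιT → Bool => x ∈ rSet (Sum.elim endsA endsT) a b c ∧
        (Nat.card (fromEdgeSet {s : Sym2 V | ∃ e, x e = true ∧
          Sum.elim endsA endsT e = s}).ConnectedComponent +
        Nat.card (fromEdgeSet {s : Sym2 V | ∃ e, x e = false ∧
          Sum.elim endsA endsT e = s}).ConnectedComponent) = t).card := by
  have hfibL : ∀ ωA : ιA → Bool, (univ.filter fun ωT : ιT → Bool => Sum.elim ωA ωT ∈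
      univ.filter fun x : ιA ⊕ ιT → Bool => x ∈ lSet (Sum.elim endsA endsT) a b c ∧
        (Nat.card (fromEdgeSet {s : Sym2 V | ∃ e, x e = true ∧
          Sum.elim endsA endsT e = s}).ConnectedComponent +
        Nat.card (fromEdgeSet {s : Sym2 V | ∃ e, x e = false ∧
          Sum.elim endsA endsT e = s}).ConnectedComponent) = t).card =
      (univ.filter fun ωT : ιT → Bool => Sum.elim ωA ωT ∈ lSet (Sum.elim endsA endsT) a b c ∧
        (Nat.card (fromEdgeSet {s : Sym2 V | ∃ e, Sum.elim ωA ωT e = true ∧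
          Sum.elim endsA endsT e = s}).ConnectedComponent +
        Nat.card (fromEdgeSet {s : Sym2 V | ∃ e, Sum.elim ωA ωT e = false ∧
          Sum.elim endsA endsT e = s}).ConnectedComponent) = t).card :=
    fun ωA => congrArg Finset.card (filter_congr fun ωT _ => by
      simp only [mem_filter, mem_univ, true_and])
  have hfibR : ∀ ωA : ιA → Bool, (univ.filter fun ωT : ιT → Bool => Sum.elim ωA ωT ∈
      univ.filter fun x : ιA ⊕ ιT → Bool => x ∈ rSet (Sum.elim endsA endsT) a b c ∧
        (Nat.card (fromEdgeSet {s : Sym2 V | ∃ e, x e = true ∧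
          Sum.elim endsA endsT e = s}).ConnectedComponent +
        Nat.card (fromEdgeSet {s : Sym2 V | ∃ e, x e = false ∧
          Sum.elim endsA endsT e = s}).ConnectedComponent) = t).card =
      (univ.filter fun ωT : ιT → Bool => Sum.elim ωA ωT ∈ rSet (Sum.elim endsA endsT) a b c ∧
        (Nat.card (fromEdgeSet {s : Sym2 V | ∃ e, Sum.elim ωA ωT e = true ∧
          Sum.elim endsA endsT e = s}).ConnectedComponent +
        Nat.card (fromEdgeSet {s : Sym2 V | ∃ e, Sum.elim ωA ωT e = false ∧
          Sum.elim endsA endsT e = s}).ConnectedComponent) = t).card :=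
    fun ωA => congrArg Finset.card (filter_congr fun ωT _ => by
      simp only [mem_filter, mem_univ, true_and])
  rw [card_eq_sum_card_fibre_left (univ.filter fun x : ιA ⊕ ιT → Bool =>
      x ∈ lSet (Sum.elim endsA endsT) a b c ∧
        (Nat.card (fromEdgeSet {s : Sym2 V | ∃ e, x e = true ∧
          Sum.elim endsA endsT e = s}).ConnectedComponent +
        Nat.card (fromEdgeSet {s : Sym2 V | ∃ e, x e = false ∧
          Sum.elim endsA endsT e = s}).ConnectedComponent) = t),
    card_eq_sum_card_fibre_left (univ.filter fun x : ιA ⊕ ιT → Bool =>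
      x ∈ rSet (Sum.elim endsA endsT) a b c ∧
        (Nat.card (fromEdgeSet {s : Sym2 V | ∃ e, x e = true ∧
          Sum.elim endsA endsT e = s}).ConnectedComponent +
        Nat.card (fromEdgeSet {s : Sym2 V | ∃ e, x e = false ∧
          Sum.elim endsA endsT e = s}).ConnectedComponent) = t)]
  simp only [hfibL, hfibR]
  exact sum_le_sum fun ωA _ => fibre_grade_le_apexBlock hsep ha hbT hbu hcT hcu h0 ωA t

end Sets

end AntipodalR1

end Summit.CriticalPhenomena.PercolationContinuityZ3.Theorems
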